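import Summits.AtomisticToContinuum.BoseEinsteinCondensation.Theorems.BECInsertionCorrectorStaticResponseBoundNearMinProductState
import Summits.AtomisticToContinuum.BoseEinsteinCondensation.Theorems.StaticResponseBound.Negative.UvThomsonFlowPotential
import HarnessLib

/-!
# Near-minimiser variation for the crux `StaticResponseBound` (stmt-AtomisticToContinuum-12057), II:
# the affine test family `(1 + τU)Φ/‖·‖`

Helper file (part 2a) for the registered stub `stub_nearMinCosSqMoment` of line `uv-thomson-force-wave` (skeleton v4,
seat c1), sequel of `…NearMinProductState.lean`.  Contents: the pointwise kinetic identities for a real amplitude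
modulated by a real multiplier (`gradDot_modulated_self`, `gradDot_sq_modulation`, `gradDot_mul_self_le`,
`gradDot_sq_self`), integrability helpers, and the registered helper `affineFamily`: for a finite-energy state `Φ`
(complex, zeros allowed), a measurable weight computing the energy and a real `C¹` lattice-periodic Bose-symmetric
multiplier `U` with `|τ| sup|U| ≤ 1/4`, the normalised state `(1+τU)Φ/‖·‖` satisfies the variational principle and the
crux's discriminant inequality with mass, energy and modulation written as explicit quadratic polynomials in `τ`.
All names of integrals are OPAQUE parameters with defining equations (no `let`), which keeps the arithmetic cheap.
References: [ReedSimonIV1978] §XIII.1–2 (Rayleigh–Ritz, first and second variations).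
-/

noncomputable section

namespace Summit.AtomisticToContinuum.BoseEinsteinCondensation.Cruxes.StaticResponseBound.UvThomsonForceWave

open MeasureTheory Filter
open scoped ENNReal NNReal BigOperators Topology
open Literature.MathematicalPhysics.QuantumManyBody.BoseGas
open Summit.AtomisticToContinuum.BoseEinsteinCondensation.Theorems.StaticResponseBound.Negative
open Summit.AtomisticToContinuum.BoseEinsteinCondensation.Theorems.StaticResponseToHMinusOne
  (ae_weight_mul_ofReal_eq integrableOn_toReal_weight_mul_norm_sq)

variable {N : ℕ} {L : ℝ}


/-! ## Part 2 — the mode `V_p` and the two test families `(1 + ηV_p)Φ`, `(1 + σV_p²)Φ` -/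

section Mode

open Summit.AtomisticToContinuum.BoseEinsteinCondensation.Theorems.StaticResponseBound.Negative.UvThomsonFlow
  (pderiv_densityWave contDiff_densityWave isLatticePeriodic_densityWave sum_coeff_sq)

/-! ### Pointwise kinetic identities for a real `C¹` amplitude `φ` modulated by `V` -/

variable {V φ : Config N → ℝ} {X : Config N}

/-- `(1 + ηV)φ = φ + η·(Vφ)` as functions. [folklore] -/
theorem one_add_smul_mul_fun (η : ℝ) (V φ : Config N → ℝ) :
    (fun Y => (1 + η * V Y) * φ Y) = φ + η • fun Y => V Y * φ Y := by
  funext Y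
  simp only [Pi.add_apply, Pi.smul_apply, smul_eq_mul]
  ring

/-- **Polarisation along the modulation**:
`|∇((1+ηV)φ)|² = |∇φ|² + 2η ∇φ·∇(Vφ) + η² |∇(Vφ)|²` at points of differentiability. [folklore] -/
theorem gradDot_modulated_self (hV : DifferentiableAt ℝ V X) (hφ : DifferentiableAt ℝ φ X) (η : ℝ) :
    gradDot (fun Y => (1 + η * V Y) * φ Y) (fun Y => (1 + η * V Y) * φ Y) X =
      gradDot φ φ X + 2 * η * gradDot φ (fun Y => V Y * φ Y) X +
        η ^ 2 * gradDot (fun Y => V Y * φ Y) (fun Y => V Y * φ Y) X := by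
  have hVφ : DifferentiableAt ℝ (fun Y => V Y * φ Y) X := hV.mul hφ
  have hs : DifferentiableAt ℝ (η • fun Y => V Y * φ Y) X := hVφ.const_smul η
  rw [one_add_smul_mul_fun, gradDot_add_add hφ hs, gradDot_smul_right, gradDot_smul_left, gradDot_smul_right]
  ring

/-- **The second family against the first**: `∇φ·∇(V²φ) = |∇(Vφ)|² − |∇V|² φ²`. [folklore] -/
theorem gradDot_sq_modulation (hV : DifferentiableAt ℝ V X) (hφ : DifferentiableAt ℝ φ X) :
    gradDot φ (fun Y => V Y ^ 2 * φ Y) X =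
      gradDot (fun Y => V Y * φ Y) (fun Y => V Y * φ Y) X - gradDot V V X * φ X ^ 2 := by
  rw [gradDot_mul_self_eq hV hφ]
  ring

/-- `|∇(Vφ)|² ≤ 2V²|∇φ|² + 2φ²|∇V|²`. [folklore] -/
theorem gradDot_mul_self_le (hV : DifferentiableAt ℝ V X) (hφ : DifferentiableAt ℝ φ X) :
    gradDot (fun Y => V Y * φ Y) (fun Y => V Y * φ Y) X ≤
      2 * V X ^ 2 * gradDot φ φ X + 2 * φ X ^ 2 * gradDot V V X := by
  unfold gradDot
  rw [Finset.mul_sum, Finset.mul_sum, ← Finset.sum_add_distrib]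
  refine Finset.sum_le_sum fun i _ => ?_
  rw [Finset.mul_sum, Finset.mul_sum, ← Finset.sum_add_distrib]
  refine Finset.sum_le_sum fun m _ => ?_
  rw [pderiv_fun_mul hV hφ]
  nlinarith [sq_nonneg (V X * pderiv i m φ X - φ X * pderiv i m V X)]

/-- `|∇(V²)|² = 4V²|∇V|²`. [folklore] -/
theorem gradDot_sq_self (hV : DifferentiableAt ℝ V X) :
    gradDot (fun Y => V Y ^ 2) (fun Y => V Y ^ 2) X = 4 * V X ^ 2 * gradDot V V X := by
  unfold gradDot
  rw [Finset.mul_sum]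
  refine Finset.sum_congr rfl fun i _ => ?_
  rw [Finset.mul_sum]
  refine Finset.sum_congr rfl fun m _ => ?_
  rw [pderiv_fun_sq hV]
  ring

end Mode


/-! ### Integrability helpers on the cell -/

section Integrability

variable {v : ℝ → ℝ≥0∞} {W : Config N → ℝ≥0∞} {Φ : PeriodicTrialState N L}

/-- For a finite-energy state and a measurable weight, `W.toReal · g · |Φ|²` is integrable on the cell for every
bounded continuous `g`. [folklore] -/
theorem integrableOn_weight_mul_bdd (hW : Measurable W)
    (hfin : (∫⁻ X in cellN N L, kineticDensity Φ.ψ X + W X * ((‖Φ.ψ X‖₊ : ℝ≥0∞)) ^ 2) ≠ ⊤)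
    {g : Config N → ℝ} (hg : Continuous g) {M : ℝ} (hM : ∀ X, |g X| ≤ M) :
    IntegrableOn (fun X => (W X).toReal * (g X * ‖Φ.ψ X‖ ^ 2)) (cellN N L) := by
  have h0 := integrableOn_toReal_weight_mul_norm_sq (Θ := Φ) hW hfin
  have hfun : (fun X => (W X).toReal * (g X * ‖Φ.ψ X‖ ^ 2)) =
      fun X => g X * ((W X).toReal * ‖Φ.ψ X‖ ^ 2) := by
    funext X; ring
  rw [hfun]
  refine Integrable.bdd_mul h0 hg.aestronglyMeasurable (c := M) ?_
  exact ae_of_all _ fun X => by rw [Real.norm_eq_abs]; exact hM X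

/-- Splitting `∫ (f + a g + b h)` on the cell. [folklore] -/
theorem integral_quad_split {f g h : Config N → ℝ} (hf : IntegrableOn f (cellN N L)) (hg : IntegrableOn g (cellN N L))
    (hh : IntegrableOn h (cellN N L)) (a b : ℝ) :
    ∫ X in cellN N L, (f X + a * g X + b * h X) =
      (∫ X in cellN N L, f X) + a * (∫ X in cellN N L, g X) + b * ∫ X in cellN N L, h X := by
  have hg' : IntegrableOn (fun X => a * g X) (cellN N L) := hg.const_mul a
  have hh' : IntegrableOn (fun X => b * h X) (cellN N L) := hh.const_mul b
  have hfg : IntegrableOn (fun X => f X + a * g X) (cellN N L) := hf.add hg'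
  rw [integral_add hfg hh', integral_add hf hg', integral_const_mul, integral_const_mul]

end Integrability

/-! ### The first test family `(1 + ηV_p)Φ/‖·‖`: energy, modulation and mass as quadratic polynomials in `η` -/

section EtaFamily

open Summit.AtomisticToContinuum.BoseEinsteinCondensation.Theorems.StaticResponseBound.Negative.UvThomsonFlow
  (contDiff_densityWave isLatticePeriodic_densityWave)

variable {v : ℝ → ℝ≥0∞} {W : Config N → ℝ≥0∞}

/-- `cosMean` is the `V_p`-moment of the Born density. [folklore] -/
theorem cosMean_eq_integral_densityWave (L : ℝ) (k : Fin 3 → ℤ) (Ψ : PeriodicTrialState N L) :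
    cosMean L k Ψ = ∫ X in cellN N L, UvThomsonFlow.densityWave L k X * ‖Ψ.ψ X‖ ^ 2 := rfl

/-- **The affine test family** `Ψ_τ = (1+τU)Φ/‖(1+τU)Φ‖`.  Let `W` be a measurable weight computing the periodic
energy, `Φ` a finite-energy periodic state, `k ∈ ℤ³`, `V = V_p` the density wave, `U` a real `C¹` lattice-periodic
Bose-symmetric multiplier with `|U| ≤ M` and `|τ| M ≤ 1/4`, `φ₁ = Re Φ`, `φ₂ = Im Φ`.  With the real numbers
`a₁ = ∫ U|Φ|²`, `a₂ = ∫ U²|Φ|²`, `b₀ = ∫ V|Φ|²`, `b₁ = ∫ VU|Φ|²`, `b₂ = ∫ VU²|Φ|²`,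
`e₁ = ∑ᵣ∫∇φᵣ·∇(Uφᵣ) + ∫ W U|Φ|²`, `e₂ = ∑ᵣ∫|∇(Uφᵣ)|² + ∫ W U²|Φ|²`:
`E₀ (1 + 2τa₁ + τ²a₂) ≤ E_Φ + 2τe₁ + τ²e₂` (variational principle: mass, energy of `Ψ_τ` are these quadratics
divided by the mass), and, if the crux's discriminant family holds at `k` with constant `B > 0`,
`(b₀ + 2τb₁ + τ²b₂)² ≤ 4B (1 + 2τa₁ + τ²a₂) ((E_Φ + 2τe₁ + τ²e₂) − E₀ (1 + 2τa₁ + τ²a₂))`. [folklore] -/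
theorem affineFamily' (hW : Measurable W)
    (hEW : ∀ Ψ : PeriodicTrialState N L, periodicEnergy v Ψ =
      ∫⁻ X in cellN N L, kineticDensity Ψ.ψ X + W X * ((‖Ψ.ψ X‖₊ : ℝ≥0∞)) ^ 2)
    (Φ : PeriodicTrialState N L) (hfin : periodicEnergy v Φ ≠ ⊤) (k : Fin 3 → ℤ) {B : ℝ} (hB : 0 < B)
    (hdisc : ∀ (t : ℝ) (Ψ : PeriodicTrialState N L), periodicEnergy v Ψ ≠ ⊤ →
      (periodicGroundStateEnergy v N L).toReal - B * t ^ 2 ≤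
        (periodicEnergy v Ψ).toReal + t * cosMean L k Ψ)
    {U : Config N → ℝ} (hU : ContDiff ℝ 1 U) (hUper : IsLatticePeriodic L U)
    (hUsymm : ∀ (σ : Equiv.Perm (Fin N)) (X : Config N), U (X ∘ σ) = U X)
    {M : ℝ} (hUbd : ∀ X, |U X| ≤ M) {τ : ℝ} (hτ : |τ| * M ≤ 1 / 4)
    {V φ₁ φ₂ : Config N → ℝ} (hVeq : V = UvThomsonFlow.densityWave L k)
    (hφ₁eq : φ₁ = fun Y => (Φ.ψ Y).re) (hφ₂eq : φ₂ = fun Y => (Φ.ψ Y).im)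
    {a₁ a₂ b₀ b₁ b₂ e₁ e₂ : ℝ}
    (ha₁ : a₁ = ∫ X in cellN N L, U X * ‖Φ.ψ X‖ ^ 2)
    (ha₂ : a₂ = ∫ X in cellN N L, U X ^ 2 * ‖Φ.ψ X‖ ^ 2)
    (hb₀ : b₀ = ∫ X in cellN N L, V X * ‖Φ.ψ X‖ ^ 2)
    (hb₁ : b₁ = ∫ X in cellN N L, V X * U X * ‖Φ.ψ X‖ ^ 2)
    (hb₂ : b₂ = ∫ X in cellN N L, V X * U X ^ 2 * ‖Φ.ψ X‖ ^ 2)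
    (he₁ : e₁ = (∫ X in cellN N L, (gradDot φ₁ (fun Y => U Y * φ₁ Y) X + gradDot φ₂ (fun Y => U Y * φ₂ Y) X)) +
      ∫ X in cellN N L, (W X).toReal * (U X * ‖Φ.ψ X‖ ^ 2))
    (he₂ : e₂ = (∫ X in cellN N L, (gradDot (fun Y => U Y * φ₁ Y) (fun Y => U Y * φ₁ Y) X +
        gradDot (fun Y => U Y * φ₂ Y) (fun Y => U Y * φ₂ Y) X)) +
      ∫ X in cellN N L, (W X).toReal * (U X ^ 2 * ‖Φ.ψ X‖ ^ 2)) :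
    (periodicGroundStateEnergy v N L).toReal * (1 + 2 * τ * a₁ + τ ^ 2 * a₂) ≤
        (periodicEnergy v Φ).toReal + 2 * τ * e₁ + τ ^ 2 * e₂ ∧
      (b₀ + 2 * τ * b₁ + τ ^ 2 * b₂) ^ 2 ≤
        4 * B * (1 + 2 * τ * a₁ + τ ^ 2 * a₂) *
          (((periodicEnergy v Φ).toReal + 2 * τ * e₁ + τ ^ 2 * e₂) -
            (periodicGroundStateEnergy v N L).toReal * (1 + 2 * τ * a₁ + τ ^ 2 * a₂)) := by
  set E₀r : ℝ := (periodicGroundStateEnergy v N L).toReal with hE₀rdef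
  set EΦ : ℝ := (periodicEnergy v Φ).toReal with hEΦdef
  have hfin' : (∫⁻ X in cellN N L, kineticDensity Φ.ψ X + W X * ((‖Φ.ψ X‖₊ : ℝ≥0∞)) ^ 2) ≠ ⊤ := by
    rw [← hEW Φ]; exact hfin
  have hVc : ContDiff ℝ 1 V := by rw [hVeq]; exact contDiff_densityWave L k
  have hUd : Differentiable ℝ U := hU.differentiable one_ne_zero
  -- the multiplier `F = 1 + τU ≥ 1/2`
  have hF : ContDiff ℝ 1 fun Y => 1 + τ * U Y := contDiff_const.add (contDiff_const.mul hU)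
  have hFper : IsLatticePeriodic L fun Y => 1 + τ * U Y := hUper.comp fun x => 1 + τ * x
  have hFsymm : ∀ (σ : Equiv.Perm (Fin N)) (X : Config N), (1 + τ * U (X ∘ σ)) = 1 + τ * U X :=
    fun σ X => by rw [hUsymm]
  have hFpos : ∀ X, 1 / 2 ≤ 1 + τ * U X := by
    intro X
    have h1 : |τ * U X| ≤ 1 / 4 := by
      rw [abs_mul]
      exact (mul_le_mul_of_nonneg_left (hUbd X) (abs_nonneg τ)).trans hτ
    linarith [neg_abs_le (τ * U X)]
  obtain ⟨Ψ, c, hc, hΨ, hcn⟩ := exists_productState Φ hF hFper hFsymm hFpos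
  -- the real multiplier `θ = c(1 + τU)`
  have hθ : ContDiff ℝ 1 fun Y => c * (1 + τ * U Y) := contDiff_const.mul hF
  have hΨ' : ∀ X, Ψ.ψ X = (((c * (1 + τ * U X) : ℝ)) : ℂ) * Φ.ψ X := hΨ
  obtain ⟨hΨfin, hE⟩ := energy_productState' hW hEW Φ hfin Ψ hθ hΨ'
  -- regularity of the real components
  have hφ₁ : ContDiff ℝ 1 φ₁ := by rw [hφ₁eq]; exact Complex.reCLM.contDiff.comp Φ.contDiff
  have hφ₂ : ContDiff ℝ 1 φ₂ := by rw [hφ₂eq]; exact Complex.imCLM.contDiff.comp Φ.contDiff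
  have hφ₁d : Differentiable ℝ φ₁ := hφ₁.differentiable one_ne_zero
  have hφ₂d : Differentiable ℝ φ₂ := hφ₂.differentiable one_ne_zero
  have hUφ₁ : ContDiff ℝ 1 fun Y => U Y * φ₁ Y := hU.mul hφ₁
  have hUφ₂ : ContDiff ℝ 1 fun Y => U Y * φ₂ Y := hU.mul hφ₂
  -- ### the kinetic energy of `Ψ` as a polynomial in `τ`
  have hkinfun : Ψ.ψ = fun Y => (((c * (1 + τ * U Y) : ℝ)) : ℂ) * Φ.ψ Y := funext hΨ'
  have hkin : cellKineticEnergy L Ψ.ψ = c ^ 2 *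
      ((∫ X in cellN N L, (gradDot φ₁ φ₁ X + gradDot φ₂ φ₂ X)) +
        2 * τ * (∫ X in cellN N L, (gradDot φ₁ (fun Y => U Y * φ₁ Y) X + gradDot φ₂ (fun Y => U Y * φ₂ Y) X)) +
        τ ^ 2 * (∫ X in cellN N L, (gradDot (fun Y => U Y * φ₁ Y) (fun Y => U Y * φ₁ Y) X +
          gradDot (fun Y => U Y * φ₂ Y) (fun Y => U Y * φ₂ Y) X))) := by
    rw [hkinfun, cellKineticEnergy_real_mul hθ Φ.contDiff L]
    have hpt : ∀ X, gradDot (fun Y => c * (1 + τ * U Y) * (Φ.ψ Y).re) (fun Y => c * (1 + τ * U Y) * (Φ.ψ Y).re) X +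
        gradDot (fun Y => c * (1 + τ * U Y) * (Φ.ψ Y).im) (fun Y => c * (1 + τ * U Y) * (Φ.ψ Y).im) X =
        c ^ 2 * ((gradDot φ₁ φ₁ X + gradDot φ₂ φ₂ X) +
          2 * τ * (gradDot φ₁ (fun Y => U Y * φ₁ Y) X + gradDot φ₂ (fun Y => U Y * φ₂ Y) X) +
          τ ^ 2 * (gradDot (fun Y => U Y * φ₁ Y) (fun Y => U Y * φ₁ Y) X +
            gradDot (fun Y => U Y * φ₂ Y) (fun Y => U Y * φ₂ Y) X)) := by
      intro X
      have h1 : (fun Y => c * (1 + τ * U Y) * (Φ.ψ Y).re) = c • fun Y => (1 + τ * U Y) * φ₁ Y := by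
        funext Y; simp only [Pi.smul_apply, smul_eq_mul, hφ₁eq]; ring
      have h2 : (fun Y => c * (1 + τ * U Y) * (Φ.ψ Y).im) = c • fun Y => (1 + τ * U Y) * φ₂ Y := by
        funext Y; simp only [Pi.smul_apply, smul_eq_mul, hφ₂eq]; ring
      rw [h1, h2, gradDot_smul_left, gradDot_smul_right, gradDot_smul_left, gradDot_smul_right,
        gradDot_modulated_self (hUd X) (hφ₁d X), gradDot_modulated_self (hUd X) (hφ₂d X)]
      ring
    simp_rw [hpt]
    rw [integral_const_mul]
    congr 1
    have i00 : IntegrableOn (fun X => gradDot φ₁ φ₁ X + gradDot φ₂ φ₂ X) (cellN N L) :=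
      integrableOn_cellN ((continuous_gradDot hφ₁ hφ₁).add (continuous_gradDot hφ₂ hφ₂)) L
    have i01 : IntegrableOn (fun X => gradDot φ₁ (fun Y => U Y * φ₁ Y) X + gradDot φ₂ (fun Y => U Y * φ₂ Y) X)
        (cellN N L) :=
      integrableOn_cellN ((continuous_gradDot hφ₁ hUφ₁).add (continuous_gradDot hφ₂ hUφ₂)) L
    have i11 : IntegrableOn (fun X => gradDot (fun Y => U Y * φ₁ Y) (fun Y => U Y * φ₁ Y) X +
        gradDot (fun Y => U Y * φ₂ Y) (fun Y => U Y * φ₂ Y) X) (cellN N L) :=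
      integrableOn_cellN ((continuous_gradDot hUφ₁ hUφ₁).add (continuous_gradDot hUφ₂ hUφ₂)) L
    exact integral_quad_split i00 i01 i11 _ _
  -- ### the potential energy of `Ψ` as a polynomial in `τ`
  have hUbd2 : ∀ X, |U X ^ 2| ≤ M ^ 2 := fun X => by
    rw [abs_pow]; exact pow_le_pow_left₀ (abs_nonneg _) (hUbd X) 2
  have hpot : ∫ X in cellN N L, (W X).toReal * (c * (1 + τ * U X) * ‖Φ.ψ X‖) ^ 2 = c ^ 2 *
      ((∫ X in cellN N L, (W X).toReal * ‖Φ.ψ X‖ ^ 2) +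
        2 * τ * (∫ X in cellN N L, (W X).toReal * (U X * ‖Φ.ψ X‖ ^ 2)) +
        τ ^ 2 * (∫ X in cellN N L, (W X).toReal * (U X ^ 2 * ‖Φ.ψ X‖ ^ 2))) := by
    have hpt : ∀ X, (W X).toReal * (c * (1 + τ * U X) * ‖Φ.ψ X‖) ^ 2 =
        c ^ 2 * ((W X).toReal * ‖Φ.ψ X‖ ^ 2 + 2 * τ * ((W X).toReal * (U X * ‖Φ.ψ X‖ ^ 2)) +
          τ ^ 2 * ((W X).toReal * (U X ^ 2 * ‖Φ.ψ X‖ ^ 2))) := fun X => by ring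
    simp_rw [hpt]
    rw [integral_const_mul]
    congr 1
    have i0 : IntegrableOn (fun X => (W X).toReal * ‖Φ.ψ X‖ ^ 2) (cellN N L) :=
      integrableOn_toReal_weight_mul_norm_sq (Θ := Φ) hW hfin'
    have i1 : IntegrableOn (fun X => (W X).toReal * (U X * ‖Φ.ψ X‖ ^ 2)) (cellN N L) :=
      integrableOn_weight_mul_bdd hW hfin' hU.continuous hUbd
    have i2 : IntegrableOn (fun X => (W X).toReal * (U X ^ 2 * ‖Φ.ψ X‖ ^ 2)) (cellN N L) :=
      integrableOn_weight_mul_bdd hW hfin' (hU.continuous.pow 2) hUbd2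
    exact integral_quad_split i0 i1 i2 _ _
  -- ### the mass and the modulation
  have hρc : Continuous fun X => ‖Φ.ψ X‖ ^ 2 := (Φ.contDiff.continuous.norm).pow 2
  have iρ : IntegrableOn (fun X => ‖Φ.ψ X‖ ^ 2) (cellN N L) := integrableOn_cellN hρc L
  have iUρ : ∀ m : ℕ, IntegrableOn (fun X => U X ^ m * ‖Φ.ψ X‖ ^ 2) (cellN N L) := fun m =>
    integrableOn_cellN ((hU.continuous.pow m).mul hρc) L
  have iVUρ : ∀ m : ℕ, IntegrableOn (fun X => UvThomsonFlow.densityWave L k X * U X ^ m * ‖Φ.ψ X‖ ^ 2)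
      (cellN N L) := fun m =>
    integrableOn_cellN (((UvThomsonFlow.continuous_densityWave L k).mul (hU.continuous.pow m)).mul hρc) L
  have hmass : ∫ X in cellN N L, (1 + τ * U X) ^ 2 * ‖Φ.ψ X‖ ^ 2 = 1 + 2 * τ * a₁ + τ ^ 2 * a₂ := by
    have hpt : ∀ X, (1 + τ * U X) ^ 2 * ‖Φ.ψ X‖ ^ 2 =
        ‖Φ.ψ X‖ ^ 2 + 2 * τ * (U X ^ 1 * ‖Φ.ψ X‖ ^ 2) + τ ^ 2 * (U X ^ 2 * ‖Φ.ψ X‖ ^ 2) := fun X => by ring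
    simp_rw [hpt]
    rw [integral_quad_split iρ (iUρ 1) (iUρ 2), integral_norm_sq_eq_one Φ, ha₁, ha₂]
    simp only [pow_one]
  have hmod : cosMean L k Ψ = c ^ 2 * (b₀ + 2 * τ * b₁ + τ ^ 2 * b₂) := by
    rw [cosMean_eq_integral_densityWave, integral_mul_norm_sq_productState _ Φ Ψ hΨ']
    have hpt : ∀ X, UvThomsonFlow.densityWave L k X * (c * (1 + τ * U X) * ‖Φ.ψ X‖) ^ 2 =
        c ^ 2 * (UvThomsonFlow.densityWave L k X * U X ^ 0 * ‖Φ.ψ X‖ ^ 2 +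
          2 * τ * (UvThomsonFlow.densityWave L k X * U X ^ 1 * ‖Φ.ψ X‖ ^ 2) +
          τ ^ 2 * (UvThomsonFlow.densityWave L k X * U X ^ 2 * ‖Φ.ψ X‖ ^ 2)) :=
      fun X => by ring
    simp_rw [hpt]
    rw [integral_const_mul, integral_quad_split (iVUρ 0) (iVUρ 1) (iVUρ 2), hb₀, hb₁, hb₂, hVeq]
    simp only [pow_one, pow_zero, mul_one]
  have hcn' : c ^ 2 * (1 + 2 * τ * a₁ + τ ^ 2 * a₂) = 1 := by rw [← hmass]; exact hcn
  -- ### the energy of `Φ` itself in the same currency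
  have hEΦ : EΦ = (∫ X in cellN N L, (gradDot φ₁ φ₁ X + gradDot φ₂ φ₂ X)) +
      ∫ X in cellN N L, (W X).toReal * ‖Φ.ψ X‖ ^ 2 := by
    show (periodicEnergy v Φ).toReal = _
    rw [toReal_energy_eq hW hEW Φ hfin]
    congr 1
    unfold cellKineticEnergy
    rw [hφ₁eq, hφ₂eq]
    refine integral_congr_ae (ae_of_all _ fun X => ?_)
    exact kineticDensityReal_eq_gradDot_re_add_im ((Φ.contDiff.differentiable one_ne_zero) X)
  -- ### assemble: `E(Ψ) = c² e(τ)`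
  have hEΨ : (periodicEnergy v Ψ).toReal = c ^ 2 * (EΦ + 2 * τ * e₁ + τ ^ 2 * e₂) := by
    rw [hE, hkin, hpot, hEΦ, he₁, he₂]
    ring
  -- ### the variational principle
  have hvar : E₀r ≤ (periodicEnergy v Ψ).toReal :=
    ENNReal.toReal_mono hΨfin (periodicGroundStateEnergy_le v Ψ)
  have hn_pos : 0 < 1 + 2 * τ * a₁ + τ ^ 2 * a₂ := by
    have : 0 < c ^ 2 := by positivity
    nlinarith
  refine ⟨?_, ?_⟩
  · have h1 := mul_le_mul_of_nonneg_right (hvar.trans_eq hEΨ) hn_pos.le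
    calc E₀r * (1 + 2 * τ * a₁ + τ ^ 2 * a₂)
        ≤ c ^ 2 * (EΦ + 2 * τ * e₁ + τ ^ 2 * e₂) * (1 + 2 * τ * a₁ + τ ^ 2 * a₂) := h1
      _ = (EΦ + 2 * τ * e₁ + τ ^ 2 * e₂) * (c ^ 2 * (1 + 2 * τ * a₁ + τ ^ 2 * a₂)) := by ring
      _ = EΦ + 2 * τ * e₁ + τ ^ 2 * e₂ := by rw [hcn', mul_one]
  · have hall : ∀ t : ℝ, E₀r - B * t ^ 2 ≤ (periodicEnergy v Ψ).toReal + t * cosMean L k Ψ :=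
      fun t => hdisc t Ψ hΨfin
    have hq := (forall_quad_iff hB).1 hall
    rw [hmod, hEΨ] at hq
    have hn2 : 0 ≤ (1 + 2 * τ * a₁ + τ ^ 2 * a₂) ^ 2 := sq_nonneg _
    have h2 := mul_le_mul_of_nonneg_left hq hn2
    have lhs : (1 + 2 * τ * a₁ + τ ^ 2 * a₂) ^ 2 * (c ^ 2 * (b₀ + 2 * τ * b₁ + τ ^ 2 * b₂)) ^ 2 =
        (c ^ 2 * (1 + 2 * τ * a₁ + τ ^ 2 * a₂)) ^ 2 * (b₀ + 2 * τ * b₁ + τ ^ 2 * b₂) ^ 2 := by ring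
    have rhs : (1 + 2 * τ * a₁ + τ ^ 2 * a₂) ^ 2 *
        (4 * B * (c ^ 2 * (EΦ + 2 * τ * e₁ + τ ^ 2 * e₂) - E₀r)) =
        4 * B * (1 + 2 * τ * a₁ + τ ^ 2 * a₂) *
          ((c ^ 2 * (1 + 2 * τ * a₁ + τ ^ 2 * a₂)) * (EΦ + 2 * τ * e₁ + τ ^ 2 * e₂) -
            E₀r * (1 + 2 * τ * a₁ + τ ^ 2 * a₂)) := by ring
    rw [lhs, rhs, hcn', one_pow, one_mul, one_mul] at h2
    exact h2

/-- **The affine test family** (registered helper form `affineFamily`, sub-goal of the stub `stub_nearMinCosSqMoment`):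
verbatim `affineFamily'` with all binders explicit. [folklore] -/
theorem affineFamily : ∀ {N : ℕ} {L : ℝ} {v : ℝ → ℝ≥0∞} {W : Config N → ℝ≥0∞}, Measurable W →
    (∀ Ψ : PeriodicTrialState N L, periodicEnergy v Ψ =
      ∫⁻ X in cellN N L, kineticDensity Ψ.ψ X + W X * ((‖Ψ.ψ X‖₊ : ℝ≥0∞)) ^ 2) →
    ∀ (Φ : PeriodicTrialState N L), periodicEnergy v Φ ≠ ⊤ → ∀ (k : Fin 3 → ℤ) {B : ℝ}, 0 < B →
    (∀ (t : ℝ) (Ψ : PeriodicTrialState N L), periodicEnergy v Ψ ≠ ⊤ →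
      (periodicGroundStateEnergy v N L).toReal - B * t ^ 2 ≤
        (periodicEnergy v Ψ).toReal + t * cosMean L k Ψ) →
    ∀ {U : Config N → ℝ}, ContDiff ℝ 1 U → IsLatticePeriodic L U →
    (∀ (σ : Equiv.Perm (Fin N)) (X : Config N), U (X ∘ σ) = U X) →
    ∀ {M : ℝ}, (∀ X, |U X| ≤ M) → ∀ {τ : ℝ}, |τ| * M ≤ 1 / 4 →
    ∀ {V φ₁ φ₂ : Config N → ℝ}, V = UvThomsonFlow.densityWave L k →
    (φ₁ = fun Y => (Φ.ψ Y).re) → (φ₂ = fun Y => (Φ.ψ Y).im) →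
    ∀ {a₁ a₂ b₀ b₁ b₂ e₁ e₂ : ℝ},
    (a₁ = ∫ X in cellN N L, U X * ‖Φ.ψ X‖ ^ 2) →
    (a₂ = ∫ X in cellN N L, U X ^ 2 * ‖Φ.ψ X‖ ^ 2) →
    (b₀ = ∫ X in cellN N L, V X * ‖Φ.ψ X‖ ^ 2) →
    (b₁ = ∫ X in cellN N L, V X * U X * ‖Φ.ψ X‖ ^ 2) →
    (b₂ = ∫ X in cellN N L, V X * U X ^ 2 * ‖Φ.ψ X‖ ^ 2) →
    (e₁ = (∫ X in cellN N L, (gradDot φ₁ (fun Y => U Y * φ₁ Y) X + gradDot φ₂ (fun Y => U Y * φ₂ Y) X)) +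
      ∫ X in cellN N L, (W X).toReal * (U X * ‖Φ.ψ X‖ ^ 2)) →
    (e₂ = (∫ X in cellN N L, (gradDot (fun Y => U Y * φ₁ Y) (fun Y => U Y * φ₁ Y) X +
        gradDot (fun Y => U Y * φ₂ Y) (fun Y => U Y * φ₂ Y) X)) +
      ∫ X in cellN N L, (W X).toReal * (U X ^ 2 * ‖Φ.ψ X‖ ^ 2)) →
    (periodicGroundStateEnergy v N L).toReal * (1 + 2 * τ * a₁ + τ ^ 2 * a₂) ≤
        (periodicEnergy v Φ).toReal + 2 * τ * e₁ + τ ^ 2 * e₂ ∧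
      (b₀ + 2 * τ * b₁ + τ ^ 2 * b₂) ^ 2 ≤
        4 * B * (1 + 2 * τ * a₁ + τ ^ 2 * a₂) *
          (((periodicEnergy v Φ).toReal + 2 * τ * e₁ + τ ^ 2 * e₂) -
            (periodicGroundStateEnergy v N L).toReal * (1 + 2 * τ * a₁ + τ ^ 2 * a₂)) :=
  fun hW hEW Φ hfin k _ hB hdisc _ hU hUper hUsymm _ hUbd _ hτ _ _ _ hVeq hφ₁eq hφ₂eq _ _ _ _ _ _ _
    ha₁ ha₂ hb₀ hb₁ hb₂ he₁ he₂ =>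
    affineFamily' hW hEW Φ hfin k hB hdisc hU hUper hUsymm hUbd hτ hVeq hφ₁eq hφ₂eq ha₁ ha₂ hb₀ hb₁ hb₂ he₁ he₂

end EtaFamily
end Summit.AtomisticToContinuum.BoseEinsteinCondensation.Cruxes.StaticResponseBound.UvThomsonForceWave

end
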